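import Summits.NavierStokesRegularity.NavierStokesRegularity.Theorems.EfficiencyFloorNearSaturationNearMaximiserSeqCoreWeakProfile
import HarnessLib

/-!
# Route `EfficiencyFloor`, crux `NearSaturationNearMaximiser` (stmt-NavierStokesRegularity-25482) on the
# `ProductionEfficiencyDecay` ladder (stmt-22866): (I') splits BY NAME into existence (proved) + regularity/decay

Def-free helper file, twenty-fourth of the group, companion of `…SeqCoreWeakProfile` (existence of the weak-class limit profile
`w₀`, `(1+|x|)^{-3/2} w₀ ∈ L²`, distributional gradient `(M_j)`).

* `weakLimit_trace_ae_eq_zero` — `Σⱼ ⟪eⱼ, M_j⟫ = 0` a.e.: the weak-limit gradient of divergence-free fields is trace free;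
* `ae_eq_zero_of_forall_integral_inner_smooth` — an `L²` field orthogonal to all smooth compactly supported fields vanishes a.e.;
* `fderiv_ae_eq_of_weakProfile`, `isDivFree_of_fderiv_ae_eq` — a `C¹` field a.e. equal to `w₀` with `∂ⱼw ∈ L²` has `∂ⱼ w = M_j`
  a.e. and is divergence free;
* `nearSaturationNearMaximiser_of_profileRegularity` — BY NAME: stmt-25482 ⟸ (I'-reg) «the weak-class limit profile `w₀` of a
  centred normalised maximising subsequence agrees a.e. with a `C^∞` field with `D⁰, D¹, D² ∈ L²»: REGULARITY AND DECAY of the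
  Lu–Doering extremising profile only — existence and the divergence constraint are no longer hypotheses.

HONEST FRAMING: (I'-reg) is NOT proved (it is the elliptic regularity of the constrained maximisers of `S/(Z^{3/4}Pal^{3/4})`
plus their square-integrability — on paper: Euler–Lagrange `(3c⋆/2)(Δ²−Δ)w + ∇π = ∇·G` with `G` quadratic in `∇w ∈ L²`, hence
`G ∈ L¹`, bootstrap, and `|ŵ(ξ)| ≲ |Ĝ(0)|/|ξ|` at the origin so `w = O(|x|⁻²) ∈ L²(ℝ³)`: no structural obstruction to the
admissible class is expected); stmt-25482, `LerayFloorGap`, `ProductionEfficiencyDecay` (stmt-22866) and Navier–Stokes regularity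
stay OPEN; no summit statement is proved. [folklore]
-/

-- the problem directory repeats the summit name (`NavierStokesRegularity/NavierStokesRegularity`)
set_option linter.dupNamespace false

noncomputable section

namespace Summit.NavierStokesRegularity.NavierStokesRegularity.Theorems

namespace NearSaturationNearMaximiser

namespace SeqCore

open Set MeasureTheory Filter Topology Function Real
open scoped InnerProductSpace ENNReal NNReal
open Literature.Analysis.FluidPDE
open Magsanop2026Enstrophy (slice_integrable)

/-! ## §4 The limit gradient is trace free (distributionally divergence free) -/

/-- **`Σⱼ ⟪eⱼ, M_j⟫ = 0` a.e.** Along admissible (divergence-free) `u_k` whose gradients converge weakly in `L²`, `∂ⱼu_k ⇀ M_j`,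
the trace of the limit gradient vanishes almost everywhere: `div u_k = Σⱼ ⟪eⱼ, ∂ⱼu_k⟫ = 0` passes to the weak limit, and an `L²`
function orthogonal to all test functions is zero a.e. [folklore] -/
theorem weakLimit_trace_ae_eq_zero {u : ℕ → EuclideanSpace ℝ (Fin 3) → EuclideanSpace ℝ (Fin 3)}
    (hu : ∀ k, ContDiff ℝ (⊤ : ℕ∞) (u k) ∧ VectorCalculus.IsDivFree (u k) ∧ (∫⁻ x, ‖iteratedFDeriv ℝ 0 (u k) x‖ₑ ^ 2 < ⊤) ∧
      (∫⁻ x, ‖iteratedFDeriv ℝ 1 (u k) x‖ₑ ^ 2 < ⊤) ∧ (∫⁻ x, ‖iteratedFDeriv ℝ 2 (u k) x‖ₑ ^ 2 < ⊤))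
    {M : Fin 3 → EuclideanSpace ℝ (Fin 3) → EuclideanSpace ℝ (Fin 3)} (hM : ∀ j, MemLp (M j) 2 volume)
    (hconv : ∀ (j : Fin 3) (ψ : EuclideanSpace ℝ (Fin 3) → EuclideanSpace ℝ (Fin 3)), MemLp ψ 2 volume →
      Tendsto (fun k => ∫ x, ⟪fderiv ℝ (u k) x (EuclideanSpace.basisFun (Fin 3) ℝ j), ψ x⟫_ℝ) atTop (𝓝 (∫ x, ⟪M j x, ψ x⟫_ℝ))) :
    (fun x => ∑ j, ⟪EuclideanSpace.basisFun (Fin 3) ℝ j, M j x⟫_ℝ) =ᵐ[volume] fun _ => (0 : ℝ) := by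
  have e2 : ENNReal.ofReal ((2 : ℕ) : ℝ) = 2 := by norm_num
  set b := EuclideanSpace.basisFun (Fin 3) ℝ with hb
  -- the scalar trace, carried by the vector field `f = (Σⱼ ⟪bⱼ, M_j⟫) • b₀`
  set f : EuclideanSpace ℝ (Fin 3) → EuclideanSpace ℝ (Fin 3) := fun x => (∑ j, ⟪b j, M j x⟫_ℝ) • b 0 with hf
  have h1 : MemLp (fun x => ∑ j, ⟪b j, M j x⟫_ℝ) 2 volume := memLp_finsetSum _ fun j _ => (hM j).const_inner (b j)
  have hfm : MemLp f 2 volume := by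
    have h : MemLp ((fun x => ∑ j, ⟪b j, M j x⟫_ℝ) • fun _ : EuclideanSpace ℝ (Fin 3) => b 0) 2 volume :=
      MemLp.smul (memLp_top_const (b 0)) h1
    exact h
  have horth : ∀ ψ : EuclideanSpace ℝ (Fin 3) → EuclideanSpace ℝ (Fin 3), Continuous ψ → HasCompactSupport ψ →
      ∫ x, ⟪f x, ψ x⟫_ℝ = 0 := by
    intro ψ hψ hψc
    -- the test fields `ψ_j = ⟪b₀, ψ⟫ bⱼ`
    have hψj : ∀ j, MemLp (fun x => ⟪b 0, ψ x⟫_ℝ • b j) 2 volume := fun j =>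
      ((continuous_const.inner hψ).smul continuous_const).memLp_of_hasCompactSupport (by
        have h : HasCompactSupport fun x => ⟪b 0, ψ x⟫_ℝ := hψc.mono fun x hx => by
          contrapose! hx
          simp only [mem_support, not_not] at hx ⊢
          rw [hx, inner_zero_right]
        have h' : HasCompactSupport ((fun x => ⟪b 0, ψ x⟫_ℝ) • fun _ : EuclideanSpace ℝ (Fin 3) => b j) := h.smul_right
        exact h')
    have IMj : ∀ j, Integrable (fun x => ⟪M j x, ⟪b 0, ψ x⟫_ℝ • b j⟫_ℝ) := fun j =>
      integrable_inner_of_memLp holderConjugate_two (by rw [e2]; exact hM j) (by rw [e2]; exact hψj j)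
    have hD2 : ∀ k j, MemLp (fun x => fderiv ℝ (u k) x (b j)) 2 volume := fun k j => by
      have h := (memLp_two_fderiv_apply (hu k).1 (hu k).2.2.2.1 (hu k).2.2.2.2 (e := b j) (by rw [hb]; simp)).2.2
      rwa [e2] at h
    have Ikj : ∀ k j, Integrable (fun x => ⟪fderiv ℝ (u k) x (b j), ⟪b 0, ψ x⟫_ℝ • b j⟫_ℝ) := fun k j =>
      integrable_inner_of_memLp holderConjugate_two (by rw [e2]; exact hD2 k j) (by rw [e2]; exact hψj j)
    -- pointwise: `⟪f, ψ⟫ = Σⱼ ⟪M_j, ψ_j⟫` and `Σⱼ ⟪∂ⱼu_k, ψ_j⟫ = ⟪b₀, ψ⟫ · div u_k = 0`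
    have ef : (∫ x, ⟪f x, ψ x⟫_ℝ) = ∑ j, ∫ x, ⟪M j x, ⟪b 0, ψ x⟫_ℝ • b j⟫_ℝ := by
      rw [← integral_finsetSum _ (fun j _ => IMj j)]
      refine integral_congr_ae (ae_of_all _ fun x => ?_)
      show ⟪(∑ j, ⟪b j, M j x⟫_ℝ) • b 0, ψ x⟫_ℝ = ∑ j, ⟪M j x, ⟪b 0, ψ x⟫_ℝ • b j⟫_ℝ
      rw [real_inner_smul_left, Finset.sum_mul]
      refine Finset.sum_congr rfl fun j _ => ?_
      rw [real_inner_smul_right, real_inner_comm (b j) (M j x), mul_comm]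
    have ek : ∀ k, (∑ j, ∫ x, ⟪fderiv ℝ (u k) x (b j), ⟪b 0, ψ x⟫_ℝ • b j⟫_ℝ) = 0 := fun k => by
      rw [← integral_finsetSum _ (fun j _ => Ikj k j)]
      refine (integral_congr_ae (ae_of_all _ fun x => ?_)).trans (integral_zero _ _)
      show ∑ j, ⟪fderiv ℝ (u k) x (b j), ⟪b 0, ψ x⟫_ℝ • b j⟫_ℝ = (0 : ℝ)
      have hdiv := (hu k).2.1 x
      rw [divergence_eq_sum_inner_fderiv b (u k) x] at hdiv
      calc ∑ j, ⟪fderiv ℝ (u k) x (b j), ⟪b 0, ψ x⟫_ℝ • b j⟫_ℝ = ⟪b 0, ψ x⟫_ℝ * ∑ j, ⟪b j, fderiv ℝ (u k) x (b j)⟫_ℝ := by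
            rw [Finset.mul_sum]
            refine Finset.sum_congr rfl fun j _ => ?_
            rw [real_inner_smul_right, real_inner_comm (b j)]
        _ = 0 := by rw [hdiv, mul_zero]
    have hsum := tendsto_finsetSum (Finset.univ : Finset (Fin 3)) fun j _ => hconv j (fun x => ⟪b 0, ψ x⟫_ℝ • b j) (hψj j)
    have h0 : Tendsto (fun k => ∑ j, ∫ x, ⟪fderiv ℝ (u k) x (b j), ⟪b 0, ψ x⟫_ℝ • b j⟫_ℝ) atTop (𝓝 0) :=
      tendsto_const_nhds.congr fun k => (ek k).symm
    rw [ef]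
    exact tendsto_nhds_unique hsum h0
  have hz := ae_eq_zero_of_forall_integral_inner_testFields hfm horth
  have hb0 : b 0 ≠ 0 := by
    intro h
    have h1 : ‖b 0‖ = 1 := by rw [hb]; simp
    rw [h, norm_zero] at h1
    exact zero_ne_one h1
  filter_upwards [hz] with x hx
  have hx' : (∑ j, ⟪b j, M j x⟫_ℝ) • b 0 = 0 := hx
  exact (smul_eq_zero.1 hx').resolve_right hb0

/-! ## §5 A smooth representative of the profile has gradient `(M_j)` and is divergence free -/

/-- An `L²` field orthogonal to all SMOOTH compactly supported fields vanishes a.e. (smooth compactly supported fields are dense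
among the continuous compactly supported ones in `L²`, `exists_smooth_compactSupport_L2_approx`). [folklore] -/
theorem ae_eq_zero_of_forall_integral_inner_smooth {f : EuclideanSpace ℝ (Fin 3) → EuclideanSpace ℝ (Fin 3)}
    (hf : MemLp f 2 volume)
    (h0 : ∀ g : EuclideanSpace ℝ (Fin 3) → EuclideanSpace ℝ (Fin 3), ContDiff ℝ (⊤ : ℕ∞) g → HasCompactSupport g →
      ∫ x, ⟪f x, g x⟫_ℝ = 0) :
    f =ᵐ[volume] 0 := by
  have e2 : ENNReal.ofReal ((2 : ℕ) : ℝ) = 2 := by norm_num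
  refine ae_eq_zero_of_forall_integral_inner_testFields hf fun ψ hψ hψc => ?_
  have hψm : MemLp ψ 2 volume := hψ.memLp_of_hasCompactSupport hψc
  set A : ℝ := (∫ x, ‖f x‖ ^ 2) ^ (1 / (2 : ℝ)) with hA
  have hA0 : 0 ≤ A := Real.rpow_nonneg (integral_nonneg fun x => by positivity) _
  -- `|∫⟪f, ψ⟫| ≤ A √δ` for every `δ > 0`
  have key : ∀ δ : ℝ, 0 < δ → |∫ x, ⟪f x, ψ x⟫_ℝ| ≤ A * δ ^ (1 / (2 : ℝ)) := by
    intro δ hδ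
    obtain ⟨g, R, -, hg, hgc, -, Iψg, hψg⟩ := exists_smooth_compactSupport_L2_approx hψ hψc hδ
    have hgm : MemLp g 2 volume := hg.continuous.memLp_of_hasCompactSupport hgc
    have mψg : MemLp (fun x => ψ x - g x) 2 volume := hψm.sub hgm
    have I1 : Integrable (fun x => ⟪f x, g x⟫_ℝ) :=
      integrable_inner_of_memLp holderConjugate_two (by rw [e2]; exact hf) (by rw [e2]; exact hgm)
    have I2 : Integrable (fun x => ⟪f x, ψ x - g x⟫_ℝ) :=
      integrable_inner_of_memLp holderConjugate_two (by rw [e2]; exact hf) (by rw [e2]; exact mψg)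
    have hsplit : (∫ x, ⟪f x, ψ x⟫_ℝ) = ∫ x, ⟪f x, ψ x - g x⟫_ℝ := by
      have h : (∫ x, ⟪f x, ψ x⟫_ℝ) = (∫ x, ⟪f x, g x⟫_ℝ) + ∫ x, ⟪f x, ψ x - g x⟫_ℝ := by
        rw [← integral_add I1 I2]
        refine integral_congr_ae (ae_of_all _ fun x => ?_)
        show ⟪f x, ψ x⟫_ℝ = ⟪f x, g x⟫_ℝ + ⟪f x, ψ x - g x⟫_ℝ
        rw [← inner_add_right, add_sub_cancel]
      rw [h, h0 g hg hgc, zero_add]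
    rw [hsplit]
    have m1 : MemLp f (ENNReal.ofReal 2) volume := by rw [ENNReal.ofReal_ofNat]; exact hf
    have m2 : MemLp (fun x => ψ x - g x) (ENNReal.ofReal 2) volume := by rw [ENNReal.ofReal_ofNat]; exact mψg
    have hH := integral_mul_norm_le_Lp_mul_Lq (μ := (volume : Measure (EuclideanSpace ℝ (Fin 3)))) Real.HolderConjugate.two_two m1 m2
    have e1 : ∫ x, ‖f x‖ ^ (2 : ℝ) = ∫ x, ‖f x‖ ^ 2 := integral_congr_ae (ae_of_all _ fun x => by simp only [Real.rpow_two])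
    have e1' : ∫ x, ‖ψ x - g x‖ ^ (2 : ℝ) = ∫ x, ‖ψ x - g x‖ ^ 2 :=
      integral_congr_ae (ae_of_all _ fun x => by simp only [Real.rpow_two])
    rw [e1, e1'] at hH
    calc |∫ x, ⟪f x, ψ x - g x⟫_ℝ| ≤ ∫ x, |⟪f x, ψ x - g x⟫_ℝ| := abs_integral_le_integral_abs
      _ ≤ ∫ x, ‖f x‖ * ‖ψ x - g x‖ := by
          refine integral_mono_of_nonneg (ae_of_all _ fun x => abs_nonneg _) ?_ (ae_of_all _ fun x => abs_real_inner_le_norm _ _)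
          haveI := Real.HolderConjugate.two_two.ennrealOfReal
          exact m1.norm.integrable_mul m2.norm
      _ ≤ A * (∫ x, ‖ψ x - g x‖ ^ 2) ^ (1 / (2 : ℝ)) := hH
      _ ≤ A * δ ^ (1 / (2 : ℝ)) := by
          refine mul_le_mul_of_nonneg_left (Real.rpow_le_rpow (integral_nonneg fun x => by positivity) hψg (by norm_num)) hA0
  -- hence `∫⟪f, ψ⟫ = 0`
  by_contra hne
  have hI : 0 < |∫ x, ⟪f x, ψ x⟫_ℝ| := abs_pos.2 hne
  set δ : ℝ := (|∫ x, ⟪f x, ψ x⟫_ℝ| / (2 * (A + 1))) ^ 2 with hδ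
  have hδ0 : 0 < δ := by rw [hδ]; positivity
  have h := key δ hδ0
  have hroot : δ ^ (1 / (2 : ℝ)) = |∫ x, ⟪f x, ψ x⟫_ℝ| / (2 * (A + 1)) := by
    rw [hδ, ← Real.sqrt_eq_rpow, Real.sqrt_sq (by positivity)]
  rw [hroot] at h
  have h1 : A / (A + 1) < 1 := (div_lt_one (by positivity)).2 (lt_add_one A)
  have h2 : A * (|∫ x, ⟪f x, ψ x⟫_ℝ| / (2 * (A + 1))) = (|∫ x, ⟪f x, ψ x⟫_ℝ| / 2) * (A / (A + 1)) := by
    field_simp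
  rw [h2] at h
  have h3 : (|∫ x, ⟪f x, ψ x⟫_ℝ| / 2) * (A / (A + 1)) < (|∫ x, ⟪f x, ψ x⟫_ℝ| / 2) * 1 :=
    mul_lt_mul_of_pos_left h1 (by positivity)
  linarith

/-- **A `C¹` representative of the weak-class profile has gradient `M_j` a.e.** If `w ∈ C¹` with `∂ⱼw ∈ L²` agrees a.e. with `w₀`,
`M_j ∈ L²`, and `∫⟪w₀, ∂ⱼψ⟫ = −∫⟪M_j, ψ⟫` for all `C¹` compactly supported `ψ`, then `∂ⱼ w = M_j` a.e. (integration by parts on the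
smooth side, then density). [folklore] -/
theorem fderiv_ae_eq_of_weakProfile {w w₀ : EuclideanSpace ℝ (Fin 3) → EuclideanSpace ℝ (Fin 3)} (hw : ContDiff ℝ 1 w)
    (j : Fin 3) (hD : MemLp (fun x => fderiv ℝ w x (EuclideanSpace.basisFun (Fin 3) ℝ j)) 2 volume) (hae : w =ᵐ[volume] w₀)
    {Mj : EuclideanSpace ℝ (Fin 3) → EuclideanSpace ℝ (Fin 3)} (hM : MemLp Mj 2 volume)
    (hprof : ∀ ψ : EuclideanSpace ℝ (Fin 3) → EuclideanSpace ℝ (Fin 3), ContDiff ℝ 1 ψ → HasCompactSupport ψ →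
      ∫ x, ⟪w₀ x, fderiv ℝ ψ x (EuclideanSpace.basisFun (Fin 3) ℝ j)⟫_ℝ = -∫ x, ⟪Mj x, ψ x⟫_ℝ) :
    (fun x => fderiv ℝ w x (EuclideanSpace.basisFun (Fin 3) ℝ j)) =ᵐ[volume] Mj := by
  have e2 : ENNReal.ofReal ((2 : ℕ) : ℝ) = 2 := by norm_num
  set e : EuclideanSpace ℝ (Fin 3) := EuclideanSpace.basisFun (Fin 3) ℝ j with he
  have hz : (fun x => fderiv ℝ w x e - Mj x) =ᵐ[volume] 0 := by
    refine ae_eq_zero_of_forall_integral_inner_smooth (hD.sub hM) fun g hg hgc => ?_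
    have hg1 : ContDiff ℝ 1 g := hg.of_le (by norm_cast)
    have hgm : MemLp g 2 volume := hg.continuous.memLp_of_hasCompactSupport hgc
    have I1 : Integrable (fun x => ⟪fderiv ℝ w x e, g x⟫_ℝ) :=
      integrable_inner_of_memLp holderConjugate_two (by rw [e2]; exact hD) (by rw [e2]; exact hgm)
    have I2 : Integrable (fun x => ⟪Mj x, g x⟫_ℝ) :=
      integrable_inner_of_memLp holderConjugate_two (by rw [e2]; exact hM) (by rw [e2]; exact hgm)
    -- `∫⟪∂ⱼw, g⟫ = -∫⟪w, ∂ⱼg⟫ = -∫⟪w₀, ∂ⱼg⟫ = ∫⟪M_j, g⟫`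
    have h1 : (∫ x, ⟪fderiv ℝ w x e, g x⟫_ℝ) = ∫ x, ⟪Mj x, g x⟫_ℝ := by
      rw [integral_inner_fderiv_apply_const_eq_neg hw hg1 hgc e]
      have hc : (∫ x, ⟪w x, fderiv ℝ g x e⟫_ℝ) = ∫ x, ⟪w₀ x, fderiv ℝ g x e⟫_ℝ :=
        integral_congr_ae (hae.mono fun x hx => by simp only [hx])
      rw [hc, hprof g hg1 hgc, neg_neg]
    calc (∫ x, ⟪fderiv ℝ w x e - Mj x, g x⟫_ℝ) = (∫ x, ⟪fderiv ℝ w x e, g x⟫_ℝ) - ∫ x, ⟪Mj x, g x⟫_ℝ := by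
          rw [← integral_sub I1 I2]
          exact integral_congr_ae (ae_of_all _ fun x => by
            show ⟪fderiv ℝ w x e - Mj x, g x⟫_ℝ = ⟪fderiv ℝ w x e, g x⟫_ℝ - ⟪Mj x, g x⟫_ℝ
            rw [inner_sub_left])
      _ = 0 := by rw [h1, sub_self]
  exact hz.mono fun x hx => sub_eq_zero.1 (by simpa using hx)

/-- **A `C¹` field whose partial derivatives are a.e. a trace-free family is divergence free**: if `∂ⱼw = M_j` a.e. for each `j`
and `Σⱼ ⟪eⱼ, M_j⟫ = 0` a.e., then `div w = 0` everywhere (`div w` is continuous and vanishes a.e.). [folklore] -/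
theorem isDivFree_of_fderiv_ae_eq {w : EuclideanSpace ℝ (Fin 3) → EuclideanSpace ℝ (Fin 3)} (hw : ContDiff ℝ 1 w)
    {M : Fin 3 → EuclideanSpace ℝ (Fin 3) → EuclideanSpace ℝ (Fin 3)}
    (hMw : ∀ j : Fin 3, (fun x => fderiv ℝ w x (EuclideanSpace.basisFun (Fin 3) ℝ j)) =ᵐ[volume] M j)
    (htr : (fun x => ∑ j, ⟪EuclideanSpace.basisFun (Fin 3) ℝ j, M j x⟫_ℝ) =ᵐ[volume] fun _ => (0 : ℝ)) :
    VectorCalculus.IsDivFree w := by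
  set b := EuclideanSpace.basisFun (Fin 3) ℝ with hb
  have hcont : Continuous fun x => ∑ j, ⟪b j, fderiv ℝ w x (b j)⟫_ℝ :=
    continuous_finsetSum _ fun j _ => continuous_const.inner ((hw.continuous_fderiv one_ne_zero).clm_apply continuous_const)
  have hall : ∀ᵐ x ∂volume, ∀ j : Fin 3, fderiv ℝ w x (b j) = M j x := eventually_all.2 fun j => (hMw j).mono fun x hx => hx
  have hae : (fun x => ∑ j, ⟪b j, fderiv ℝ w x (b j)⟫_ℝ) =ᵐ[volume] fun _ => (0 : ℝ) := by
    filter_upwards [hall, htr] with x hx hx'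
    rw [← hx']
    exact Finset.sum_congr rfl fun j _ => by rw [hx j]
  have heq := (Continuous.ae_eq_iff_eq volume hcont continuous_const).1 hae
  intro x
  rw [divergence_eq_sum_inner_fderiv b w x]
  exact congrFun heq x


/-! ## §6 By name: stmt-25482 from the regularity and decay of the weak-class limit profile -/

/-- **`NearSaturationNearMaximiser` (stmt-25482) from the REGULARITY AND DECAY of the weak-class limit profile alone, BY NAME.**
(I'-reg) — for the sharp constant, along every centred normalised maximising sequence `v` and every subsequence `φ₀` on which
the velocity gradients converge weakly in `L²` to `(M_j)`: every measurable `w₀` with `(1+|x|)^{-3/2} w₀ ∈ L²(ℝ³)` and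
distributional gradient `(M_j)` (`∫⟪w₀, ∂ⱼψ⟫ = −∫⟪M_j, ψ⟫` on `C¹_c`) agrees a.e. with a `C^∞` field `w` with `D⁰w, D¹w, D²w ∈ L²`.
Such a `w₀` EXISTS unconditionally and is unique a.e. (`exists_weakProfile`); the smooth representative then has `∂ⱼw = M_j`
a.e. (`fderiv_ae_eq_of_weakProfile`) and is divergence free (`weakLimit_trace_ae_eq_zero`, `isDivFree_of_fderiv_ae_eq`), so (I')
of `nearSaturationNearMaximiser_of_gradientProfile` follows. (I'-reg) is the elliptic regularity + square-integrability of the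
Lu–Doering extremising profile and is NOT proved here. [folklore] -/
theorem nearSaturationNearMaximiser_of_profileRegularity
    (HR : ∀ c : ℝ, (0 < c ∧ (∀ v : EuclideanSpace ℝ (Fin 3) → EuclideanSpace ℝ (Fin 3), (ContDiff ℝ (⊤ : ℕ∞) v ∧
      Literature.Analysis.FluidPDE.VectorCalculus.IsDivFree v ∧ (∫⁻ x, ‖iteratedFDeriv ℝ 0 v x‖ₑ ^ 2 < ⊤) ∧
      (∫⁻ x, ‖iteratedFDeriv ℝ 1 v x‖ₑ ^ 2 < ⊤) ∧ (∫⁻ x, ‖iteratedFDeriv ℝ 2 v x‖ₑ ^ 2 < ⊤)) → (∫ x,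
      ⟪Literature.Analysis.FluidPDE.curl v x, fderiv ℝ v x (Literature.Analysis.FluidPDE.curl v x)⟫_ℝ) ≤ c *
      (∫ x, ‖Literature.Analysis.FluidPDE.curl v x‖ ^ 2) ^ (3 / 4 : ℝ) * (∫ x,
      Literature.Analysis.FluidPDE.frobeniusNormSq (fderiv ℝ (Literature.Analysis.FluidPDE.curl v) x)) ^ (3 / 4 : ℝ)) ∧ ∀ c' : ℝ, (∀ w : EuclideanSpace ℝ (Fin 3) → EuclideanSpace ℝ (Fin 3), (ContDiff ℝ (⊤ : ℕ∞) w ∧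
      Literature.Analysis.FluidPDE.VectorCalculus.IsDivFree w ∧ (∫⁻ x, ‖iteratedFDeriv ℝ 0 w x‖ₑ ^ 2 < ⊤) ∧
      (∫⁻ x, ‖iteratedFDeriv ℝ 1 w x‖ₑ ^ 2 < ⊤) ∧ (∫⁻ x, ‖iteratedFDeriv ℝ 2 w x‖ₑ ^ 2 < ⊤)) → (∫ x,
      ⟪Literature.Analysis.FluidPDE.curl w x, fderiv ℝ w x (Literature.Analysis.FluidPDE.curl w x)⟫_ℝ) ≤ c' *
      (∫ x, ‖Literature.Analysis.FluidPDE.curl w x‖ ^ 2) ^ (3 / 4 : ℝ) * (∫ x,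
      Literature.Analysis.FluidPDE.frobeniusNormSq (fderiv ℝ (Literature.Analysis.FluidPDE.curl w) x)) ^ (3 / 4 : ℝ)) → c ≤ c') →
      ∀ K δ : ℝ, 0 < K → 0 < δ → ∀ v : ℕ → EuclideanSpace ℝ (Fin 3) → EuclideanSpace ℝ (Fin 3),
      (∀ n, (ContDiff ℝ (⊤ : ℕ∞) (v n) ∧
      Literature.Analysis.FluidPDE.VectorCalculus.IsDivFree (v n) ∧ (∫⁻ x, ‖iteratedFDeriv ℝ 0 (v n) x‖ₑ ^ 2 < ⊤) ∧
      (∫⁻ x, ‖iteratedFDeriv ℝ 1 (v n) x‖ₑ ^ 2 < ⊤) ∧ (∫⁻ x, ‖iteratedFDeriv ℝ 2 (v n) x‖ₑ ^ 2 < ⊤))) →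
      (∀ n, (∫ x, ‖Literature.Analysis.FluidPDE.curl (v n) x‖ ^ 2) = 1) →
      (∀ n, (∫ x, Literature.Analysis.FluidPDE.frobeniusNormSq (fderiv ℝ (Literature.Analysis.FluidPDE.curl (v n)) x)) = 1) →
      Tendsto (fun n => ∫ x, ⟪Literature.Analysis.FluidPDE.curl (v n) x, fderiv ℝ (v n) x
        (Literature.Analysis.FluidPDE.curl (v n) x)⟫_ℝ) atTop (𝓝 c) →
      (∀ᶠ n in atTop, δ ≤ ∫ x in Metric.ball (0 : EuclideanSpace ℝ (Fin 3)) K, ‖Literature.Analysis.FluidPDE.curl (v n) x‖ ^ 2) →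
      ∀ (φ₀ : ℕ → ℕ) (M : Fin 3 → EuclideanSpace ℝ (Fin 3) → EuclideanSpace ℝ (Fin 3)), StrictMono φ₀ →
      (∀ j, MemLp (M j) 2 volume) →
      (∀ (j : Fin 3) (ψ : EuclideanSpace ℝ (Fin 3) → EuclideanSpace ℝ (Fin 3)), MemLp ψ 2 volume →
        Tendsto (fun k => ∫ x, ⟪fderiv ℝ (v (φ₀ k)) x (EuclideanSpace.basisFun (Fin 3) ℝ j), ψ x⟫_ℝ) atTop
          (𝓝 (∫ x, ⟪M j x, ψ x⟫_ℝ))) →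
      ∀ w₀ : EuclideanSpace ℝ (Fin 3) → EuclideanSpace ℝ (Fin 3), AEStronglyMeasurable w₀ volume →
        MemLp (fun x => ((1 : ℝ) + ‖x‖) ^ (-(3 / 2 : ℝ)) • w₀ x) 2 volume →
        (∀ (j : Fin 3) (ψ : EuclideanSpace ℝ (Fin 3) → EuclideanSpace ℝ (Fin 3)), ContDiff ℝ 1 ψ → HasCompactSupport ψ →
          ∫ x, ⟪w₀ x, fderiv ℝ ψ x (EuclideanSpace.basisFun (Fin 3) ℝ j)⟫_ℝ = -∫ x, ⟪M j x, ψ x⟫_ℝ) →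
        ∃ w : EuclideanSpace ℝ (Fin 3) → EuclideanSpace ℝ (Fin 3), ContDiff ℝ (⊤ : ℕ∞) w ∧
          (∫⁻ x, ‖iteratedFDeriv ℝ 0 w x‖ₑ ^ 2 < ⊤) ∧ (∫⁻ x, ‖iteratedFDeriv ℝ 1 w x‖ₑ ^ 2 < ⊤) ∧
          (∫⁻ x, ‖iteratedFDeriv ℝ 2 w x‖ₑ ^ 2 < ⊤) ∧ w =ᵐ[volume] w₀) :
    Summit.NavierStokesRegularity.NavierStokesRegularity.Theses.EfficiencyFloor.NearSaturationNearMaximiser := by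
  refine nearSaturationNearMaximiser_of_gradientProfile
    fun c hsharp K δ hK hδ v hAdm hZ1 hP1 hS hcen φ₀ M hφ₀ hM hconv => ?_
  -- EXISTENCE of the weak-class profile along `u = v ∘ φ₀` (unconditional)
  have hu : ∀ k, ContDiff ℝ (⊤ : ℕ∞) (v (φ₀ k)) ∧ VectorCalculus.IsDivFree (v (φ₀ k)) ∧
      (∫⁻ x, ‖iteratedFDeriv ℝ 0 (v (φ₀ k)) x‖ₑ ^ 2 < ⊤) ∧ (∫⁻ x, ‖iteratedFDeriv ℝ 1 (v (φ₀ k)) x‖ₑ ^ 2 < ⊤) ∧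
      (∫⁻ x, ‖iteratedFDeriv ℝ 2 (v (φ₀ k)) x‖ₑ ^ 2 < ⊤) := fun k => hAdm (φ₀ k)
  have hZ : ∀ k, ∫ x, ‖curl (v (φ₀ k)) x‖ ^ 2 ≤ 1 := fun k => (hZ1 (φ₀ k)).le
  obtain ⟨w₀, hw₀m, hw₀2, hprof⟩ := exists_weakProfile (u := fun k => v (φ₀ k)) hu hZ hconv
  -- REGULARITY AND DECAY (the hypothesis)
  obtain ⟨w, hw, h0, h1, h2, hae⟩ := HR c hsharp K δ hK hδ v hAdm hZ1 hP1 hS hcen φ₀ M hφ₀ hM hconv w₀ hw₀m hw₀2 hprof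
  have hw1 : ContDiff ℝ 1 w := hw.of_le (by norm_cast)
  have e2 : ENNReal.ofReal ((2 : ℕ) : ℝ) = 2 := by norm_num
  have hD : ∀ j, MemLp (fun x => fderiv ℝ w x (EuclideanSpace.basisFun (Fin 3) ℝ j)) 2 volume := fun j => by
    have h := (memLp_two_fderiv_apply hw h1 h2 (e := EuclideanSpace.basisFun (Fin 3) ℝ j) (by simp)).2.2
    rwa [e2] at h
  have hMw : ∀ j, (fun x => fderiv ℝ w x (EuclideanSpace.basisFun (Fin 3) ℝ j)) =ᵐ[volume] M j := fun j =>
    fderiv_ae_eq_of_weakProfile hw1 j (hD j) hae (hM j) (hprof j)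
  have hdiv : VectorCalculus.IsDivFree w := isDivFree_of_fderiv_ae_eq hw1 hMw (weakLimit_trace_ae_eq_zero hu hM hconv)
  exact ⟨w, ⟨hw, hdiv, h0, h1, h2⟩, hMw⟩

end SeqCore

end NearSaturationNearMaximiser

end Summit.NavierStokesRegularity.NavierStokesRegularity.Theorems

end
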